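import Summits.Langlands.Langlands.Theses.RamifiedCoefficientSeed
import Literature.NumberTheory.GaloisRepresentations.FramedRepTwist

/-!
# `AdjointSeedFromDuality` (crux stmt-Langlands-16780, route `RamifiedCoefficientSeed`):
# the duality hypothesis H1 and the parity hypothesis H3 are NECESSARY — both are implied by the
# conclusion — hence load-bearing (negative-side support, refuter cdisprove seat; does NOT refute the crux)

The crux: for `p ≥ 5` and `ρ : Γ_ℚ →ₜ* GL₃(ℚ̄_p)` with
H1 `∃ ν, ∀ σ, ‖tr ρ(σ) − ν(σ) tr ρ(σ⁻¹)‖ < 1` (residual essential self-duality),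
H2 `ρ|Γ_{ℚ(ζ_p)}` residually absolutely irreducible, and
H3 a complex conjugation `c` with `tr ρ(c) = ±1`,
there are an ODD `ρ₀ : Γ_ℚ →ₜ* GL₂(ℚ̄_p)` and `η` with `∀ σ, ‖tr ρ(σ) − η(σ)(tr ρ₀(σ)²/det ρ₀(σ) − 1)‖ < 1`
(`ρ̄ ≅ η̄ ⊗ ad⁰ ρ̄₀`).  Sorry-free content of this file:

* `forces_parity` — the CONCLUSION alone implies that EVERY complex conjugation `c` has
  `‖tr ρ(c) − 1‖ < 1 ∨ ‖tr ρ(c) + 1‖ < 1`: `ρ₀(c)` is an involution of determinant `−1` in `GL₂`, so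
  its trace is `0` (`trace_eq_zero_of_mul_self_eq_one`), `tr ad⁰ρ₀(c) = −1`, and `η(c) = ±1`.
* `forces_duality` — the CONCLUSION alone implies H1, with `ν = η²` (`ad⁰` is self-dual:
  `adTrace_inv`; continuous `GL₁(ℚ̄_p)`-valued characters of the compact `Γ_ℚ` take unit-norm values:
  `norm_entry_eq_one`).
* `false_without_parity_of_even` — consequently, at any `p ≠ 2`, a single `ρ` satisfying H1 and H2 on
  which some complex conjugation acts trivially (an EVEN witness, e.g. the rotation representation of a
  totally real `S₄`-quartic field, or `ad⁰` of an even icosahedral representation — not constructible in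
  the tree today) falsifies the H3-less crux at `p` (stated inline; no proposition is defined under
  `Summits/`).
* `false_without_duality_of_nonSelfDual` — and a single `ρ` satisfying H2 and H3 but not H1 (e.g. the
  `3`-dimensional `PSL₂(𝔽₇)` Artin representation at `p ∤ 14·disc`) falsifies the H1-less crux at `p`.

Moral for provers: H1 and H3 are exactly the residual shadow of "`η ⊗ ad⁰(odd)`"; nothing in the crux
is decorative except that H2 is only used through absolute irreducibility of `ρ̄` on `Γ_ℚ`.
-/

noncomputable section

-- `Summit.Langlands.Langlands.…` repeats a namespace component by design (D-0017 nested layout).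
set_option linter.dupNamespace false

namespace Summit.Langlands.Langlands.Theorems.AdjointSeedFromDuality.Negative

open scoped MatrixGroups
open Summit.Langlands.Langlands.Theses.RamifiedCoefficientSeed
open Literature.NumberTheory.GaloisRepresentations

/-! ### Linear algebra in rank 2 -/

/-- An involution of determinant `-1` in `M₂(F)` has trace `0`: the diagonal entries of `M² = 1`
and `det M = -1` give `(tr M)² = 0`. [folklore] -/
theorem trace_eq_zero_of_mul_self_eq_one {F : Type*} [Field F] {M : Matrix (Fin 2) (Fin 2) F}
    (hM : M * M = 1) (hdet : M.det = -1) : M.trace = 0 := by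
  have h00 : (M * M) 0 0 = (1 : Matrix (Fin 2) (Fin 2) F) 0 0 := by rw [hM]
  have h11 : (M * M) 1 1 = (1 : Matrix (Fin 2) (Fin 2) F) 1 1 := by rw [hM]
  simp only [Matrix.mul_apply, Fin.sum_univ_two, Matrix.one_apply_eq] at h00 h11
  rw [Matrix.det_fin_two] at hdet
  rw [Matrix.trace_fin_two]
  have hsq : (M 0 0 + M 1 1) ^ 2 = 0 := by linear_combination h00 + h11 + 2 * hdet
  exact (pow_eq_zero_iff two_ne_zero).mp hsq

/-- **`ad⁰` is self-dual in rank 2**: `tr(M⁻¹)²/det(M⁻¹) − 1 = tr(M)²/det M − 1` for `M ∈ GL₂(F)`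
(`tr ad⁰(g) = tr(g)²/det g − 1`). [folklore] -/
theorem adTrace_inv {F : Type*} [Field F] (M : Matrix (Fin 2) (Fin 2) F) (hM : M.det ≠ 0) :
    (M⁻¹).trace ^ 2 * ((M⁻¹).det)⁻¹ - 1 = M.trace ^ 2 * (M.det)⁻¹ - 1 := by
  have hinv : M⁻¹ = (M.det)⁻¹ • M.adjugate := by
    rw [Matrix.inv_def, Ring.inverse_eq_inv']
  rw [Matrix.det_nonsing_inv, Ring.inverse_eq_inv', inv_inv, hinv, Matrix.trace_smul,
    Matrix.adjugate_fin_two, Matrix.trace_fin_two_of, Matrix.trace_fin_two, smul_eq_mul]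
  field_simp
  ring

/-! ### Entries of continuous `GL₁(ℚ̄_p)`-valued characters of `Γ_ℚ` -/

section RankOne

variable {p : ℕ} [Fact p.Prime]

/-- `(η σ)₀₀ · (η τ)₀₀ = (η (σ τ))₀₀` for a `GL₁`-valued character. [folklore] -/
theorem entry_mul (η : FramedGaloisRep ℚ (PadicAlgCl p) 1) (σ τ : Field.absoluteGaloisGroup ℚ) :
    (η σ).val 0 0 * (η τ).val 0 0 = (η (σ * τ)).val 0 0 := by
  rw [map_mul, Units.val_mul, Matrix.mul_apply, Fin.sum_univ_one]

/-- `(η 1)₀₀ = 1`. [folklore] -/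
theorem entry_one (η : FramedGaloisRep ℚ (PadicAlgCl p) 1) : (η 1).val 0 0 = 1 := by
  rw [map_one, Units.val_one, Matrix.one_apply_eq]

/-- `(η (σⁿ))₀₀ = ((η σ)₀₀)ⁿ`. [folklore] -/
theorem entry_pow (η : FramedGaloisRep ℚ (PadicAlgCl p) 1) (σ : Field.absoluteGaloisGroup ℚ)
    (n : ℕ) : (η (σ ^ n)).val 0 0 = ((η σ).val 0 0) ^ n := by
  induction n with
  | zero => rw [pow_zero, pow_zero, entry_one]
  | succ n ih => rw [pow_succ, ← entry_mul, ih, pow_succ]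

/-- The entry function of a continuous `GL₁`-valued character is continuous. [folklore] -/
theorem continuous_entry (η : FramedGaloisRep ℚ (PadicAlgCl p) 1) :
    Continuous fun σ => (η σ).val 0 0 :=
  (Units.continuous_val.comp (map_continuous η)).matrix_elem 0 0

/-- **Values of a continuous character `Γ_ℚ → GL₁(ℚ̄_p)` have norm `≤ 1`**: `Γ_ℚ` is compact, so
`σ ↦ ‖η(σ)‖` is bounded, while `‖η(σⁿ)‖ = ‖η(σ)‖ⁿ`. [folklore] -/
theorem norm_entry_le_one (η : FramedGaloisRep ℚ (PadicAlgCl p) 1)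
    (σ : Field.absoluteGaloisGroup ℚ) : ‖(η σ).val 0 0‖ ≤ 1 := by
  by_contra hlt
  push Not at hlt
  have hcont : Continuous fun τ => ‖(η τ).val 0 0‖ := continuous_norm.comp (continuous_entry η)
  obtain ⟨B, hB⟩ := (isCompact_range hcont).bddAbove
  obtain ⟨n, hn⟩ := pow_unbounded_of_one_lt B hlt
  have hle : ‖(η (σ ^ n)).val 0 0‖ ≤ B := hB ⟨σ ^ n, rfl⟩
  rw [entry_pow, norm_pow] at hle
  exact absurd (lt_of_lt_of_le hn hle) (lt_irrefl _)

/-- **Values of a continuous character `Γ_ℚ → GL₁(ℚ̄_p)` have norm exactly `1`.** [folklore] -/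
theorem norm_entry_eq_one (η : FramedGaloisRep ℚ (PadicAlgCl p) 1)
    (σ : Field.absoluteGaloisGroup ℚ) : ‖(η σ).val 0 0‖ = 1 := by
  have h1 := norm_entry_le_one η σ
  have h2 := norm_entry_le_one η σ⁻¹
  have hprod : ‖(η σ).val 0 0‖ * ‖(η σ⁻¹).val 0 0‖ = 1 := by
    rw [← norm_mul, entry_mul, mul_inv_cancel, entry_one, norm_one]
  nlinarith [norm_nonneg ((η σ).val 0 0), norm_nonneg ((η σ⁻¹).val 0 0)]

/-- The entry of the square character `σ ↦ det(η σ)² · 1 ∈ GL₁(ℚ̄_p)` (tree `FramedRep.scalar`,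
`FramedRep.det`) is the square of the entry of `η`. [folklore] -/
theorem sqChar_entry (η : FramedGaloisRep ℚ (PadicAlgCl p) 1) (σ : Field.absoluteGaloisGroup ℚ) :
    (((FramedRep.scalar (PadicAlgCl p) 1).comp (FramedRep.det η * FramedRep.det η)) σ).val 0 0 =
      ((η σ).val 0 0) ^ 2 := by
  show (algebraMap (PadicAlgCl p) (Matrix (Fin 1) (Fin 1) (PadicAlgCl p))
    (((FramedRep.det η * FramedRep.det η) σ : (PadicAlgCl p)ˣ) : PadicAlgCl p)) 0 0 = _
  rw [Matrix.algebraMap_matrix_apply, if_pos rfl, ContinuousMonoidHom.mul_apply, Units.val_mul,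
    FramedRep.det_apply, Matrix.GeneralLinearGroup.val_det_apply, Matrix.det_fin_one, sq]
  rfl

/-- `‖n‖ = 1` in `ℚ̄_p` for `n` prime to `p` (the norm of `PadicAlgCl p` extends the `p`-adic norm).
[folklore] -/
theorem norm_natCast_eq_one {n : ℕ} (h : p.Coprime n) : ‖(n : PadicAlgCl p)‖ = 1 := by
  have h1 : ‖((n : ℚ_[p]) : PadicAlgCl p)‖ = ‖(n : ℚ_[p])‖ := PadicAlgCl.norm_extends p _
  rw [Padic.norm_natCast_eq_one_iff.mpr h] at h1
  have h2 : ((n : ℚ_[p]) : PadicAlgCl p) = (n : PadicAlgCl p) :=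
    map_natCast (algebraMap ℚ_[p] (PadicAlgCl p)) n
  rwa [h2] at h1

end RankOne

/-! ### Necessity of H3 and H1 -/

section Necessity

variable {p : ℕ} [Fact p.Prime]

/-- **The conclusion of `AdjointSeedFromDuality` forces residual parity at EVERY complex
conjugation.**  If `ρ̄ ≅ η̄ ⊗ ad⁰ ρ̄₀` in trace-congruence form with `ρ₀` odd, then for every complex
conjugation `c`: `‖tr ρ(c) − 1‖ < 1 ∨ ‖tr ρ(c) + 1‖ < 1` — `ρ₀(c)` is an involution of determinant
`−1`, so `tr ρ₀(c) = 0` and `tr ad⁰ρ₀(c) = −1`, while `η(c)² = 1`.  No hypothesis on `p`.  Hence the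
parity hypothesis H3 of the crux is necessary (in its residual form), not an artefact. [folklore] -/
theorem forces_parity {ρ : FramedGaloisRep ℚ (PadicAlgCl p) 3}
    (h : ∃ (ρ₀ : FramedGaloisRep ℚ (PadicAlgCl p) 2) (η : FramedGaloisRep ℚ (PadicAlgCl p) 1),
      ρ₀.IsOdd ∧ ∀ σ, ‖(ρ σ).val.trace -
        (η σ).val 0 0 * ((ρ₀ σ).val.trace ^ 2 * ((ρ₀ σ).val.det)⁻¹ - 1)‖ < 1)
    {φ : ℚ →+* ℝ} {c : Field.absoluteGaloisGroup ℚ} (hc : IsComplexConjugation φ c) :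
    ‖(ρ c).val.trace - 1‖ < 1 ∨ ‖(ρ c).val.trace + 1‖ < 1 := by
  obtain ⟨ρ₀, η, hodd, hcong⟩ := h
  have hc2 : c * c = 1 := by rw [← sq]; exact hc.sq_eq_one
  have hM : (ρ₀ c).val * (ρ₀ c).val = 1 := by
    rw [← Units.val_mul, ← map_mul, hc2, map_one, Units.val_one]
  have hdet : (ρ₀ c).val.det = -1 := by
    rw [← Matrix.GeneralLinearGroup.val_det_apply, hodd φ c hc, Units.val_neg, Units.val_one]
  have htr : (ρ₀ c).val.trace = 0 := trace_eq_zero_of_mul_self_eq_one hM hdet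
  have hη : (η c).val 0 0 * (η c).val 0 0 = 1 := by rw [entry_mul, hc2, entry_one]
  have hc' := hcong c
  rw [htr] at hc'
  have hsimp : (0 : PadicAlgCl p) ^ 2 * ((ρ₀ c).val.det)⁻¹ - 1 = -1 := by ring
  rw [hsimp, mul_neg, mul_one, sub_neg_eq_add] at hc'
  rcases mul_self_eq_one_iff.mp hη with h1 | h1
  · right; rwa [h1] at hc'
  · left; rwa [h1, ← sub_eq_add_neg] at hc'

/-- **The conclusion of `AdjointSeedFromDuality` forces its duality hypothesis H1** (with `ν = η²`,
realised as `FramedRep.scalar ∘ (det η)²`): `ad⁰` is self-dual (`adTrace_inv`), so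
`tr ρ(σ⁻¹) ≡ η(σ)⁻¹ · tr ad⁰ρ₀(σ)` and `tr ρ(σ) ≡ η(σ)² tr ρ(σ⁻¹) (mod 𝔪)`; the estimate uses
`‖η(σ)‖ = 1` and the ultrametric inequality.  No hypothesis on `p`.  Hence H1 is necessary. [folklore] -/
theorem forces_duality {ρ : FramedGaloisRep ℚ (PadicAlgCl p) 3}
    (h : ∃ (ρ₀ : FramedGaloisRep ℚ (PadicAlgCl p) 2) (η : FramedGaloisRep ℚ (PadicAlgCl p) 1),
      ρ₀.IsOdd ∧ ∀ σ, ‖(ρ σ).val.trace -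
        (η σ).val 0 0 * ((ρ₀ σ).val.trace ^ 2 * ((ρ₀ σ).val.det)⁻¹ - 1)‖ < 1) :
    ∃ ν : FramedGaloisRep ℚ (PadicAlgCl p) 1,
      ∀ σ, ‖(ρ σ).val.trace - (ν σ).val 0 0 * (ρ σ⁻¹).val.trace‖ < 1 := by
  obtain ⟨ρ₀, η, -, hcong⟩ := h
  refine ⟨(FramedRep.scalar (PadicAlgCl p) 1).comp (FramedRep.det η * FramedRep.det η),
    fun σ => ?_⟩
  rw [sqChar_entry]
  have hA' : (ρ₀ σ⁻¹).val.trace ^ 2 * ((ρ₀ σ⁻¹).val.det)⁻¹ - 1 =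
      (ρ₀ σ).val.trace ^ 2 * ((ρ₀ σ).val.det)⁻¹ - 1 := by
    rw [map_inv, Matrix.coe_units_inv]
    exact adTrace_inv _ (Matrix.GeneralLinearGroup.det_ne_zero _)
  have hee' : (η σ).val 0 0 * (η σ⁻¹).val 0 0 = 1 := by rw [entry_mul, mul_inv_cancel, entry_one]
  have h1 := hcong σ
  have h2 := hcong σ⁻¹
  rw [hA'] at h2
  set e := (η σ).val 0 0
  set e' := (η σ⁻¹).val 0 0
  set t := (ρ σ).val.trace
  set t' := (ρ σ⁻¹).val.trace
  set A := (ρ₀ σ).val.trace ^ 2 * ((ρ₀ σ).val.det)⁻¹ - 1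
  have key : t - e ^ 2 * t' = (t - e * A) + -(e ^ 2 * (t' - e' * A)) := by
    linear_combination (-(e * A)) * hee'
  rw [key]
  calc ‖(t - e * A) + -(e ^ 2 * (t' - e' * A))‖
      ≤ max ‖t - e * A‖ ‖-(e ^ 2 * (t' - e' * A))‖ := IsUltrametricDist.norm_add_le_max _ _
    _ < 1 := by
      refine max_lt h1 ?_
      rw [norm_neg, norm_mul, norm_pow, norm_entry_eq_one, one_pow, one_mul]
      exact h2

/-! ### The H3-less and H1-less cruxes die on the obvious witnesses -/

/-- For `p ≠ 2`, if `ρ(c) = 1` then `tr ρ(c) = 3` and `‖3 ∓ 1‖ = ‖2‖ = ‖4‖ = 1`, so the residual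
parity conclusion of `forces_parity` FAILS at `c`. [folklore] -/
theorem not_residualParity_of_apply_eq_one (hp2 : p ≠ 2) {ρ : FramedGaloisRep ℚ (PadicAlgCl p) 3}
    {c : Field.absoluteGaloisGroup ℚ} (h : ρ c = 1) :
    ¬ (‖(ρ c).val.trace - 1‖ < 1 ∨ ‖(ρ c).val.trace + 1‖ < 1) := by
  have hc2 : p.Coprime 2 := (Nat.coprime_primes Fact.out Nat.prime_two).mpr hp2
  have hc4 : p.Coprime 4 := by simpa using Nat.Coprime.mul_right hc2 hc2
  have htr : (ρ c).val.trace = 3 := by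
    rw [h, Units.val_one, Matrix.trace_one, Fintype.card_fin, Nat.cast_ofNat]
  rw [htr, show (3 : PadicAlgCl p) - 1 = (2 : ℕ) by norm_num,
    show (3 : PadicAlgCl p) + 1 = (4 : ℕ) by norm_num, norm_natCast_eq_one hc2,
    norm_natCast_eq_one hc4]
  simp

/-- **The parity hypothesis H3 is load-bearing.**  At any prime `p ≠ 2`: one `ρ : Γ_ℚ →ₜ* GL₃(ℚ̄_p)`
satisfying H1 and H2 on which a complex conjugation acts trivially (an EVEN essentially self-dual
residually irreducible rank-3 representation; on paper: the rotation representation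
`Gal(M/ℚ) ≅ S₄ ↪ SO₃(ℤ)` of a totally real `S₄`-quartic field `M`, or `ad⁰` of an even icosahedral
representation — neither constructible in the tree today) falsifies the crux WITH H3 DROPPED at this
`p` (the H3-less statement is written inline). [folklore] -/
theorem false_without_parity_of_even (hp2 : p ≠ 2) (ρ : FramedGaloisRep ℚ (PadicAlgCl p) 3)
    (hdual : ∃ ν : FramedGaloisRep ℚ (PadicAlgCl p) 1,
      ∀ σ, ‖(ρ σ).val.trace - (ν σ).val 0 0 * (ρ σ⁻¹).val.trace‖ < 1)
    (hirr : (ρ.restrictField (CyclotomicField p ℚ)).IsResiduallyAbsIrreducible)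
    {φ : ℚ →+* ℝ} {c : Field.absoluteGaloisGroup ℚ} (hc : IsComplexConjugation φ c)
    (heven : ρ c = 1) :
    ¬ (∀ ρ' : FramedGaloisRep ℚ (PadicAlgCl p) 3,
        (∃ ν : FramedGaloisRep ℚ (PadicAlgCl p) 1,
          ∀ σ, ‖(ρ' σ).val.trace - (ν σ).val 0 0 * (ρ' σ⁻¹).val.trace‖ < 1) →
        (ρ'.restrictField (CyclotomicField p ℚ)).IsResiduallyAbsIrreducible →
        ∃ (ρ₀ : FramedGaloisRep ℚ (PadicAlgCl p) 2) (η : FramedGaloisRep ℚ (PadicAlgCl p) 1),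
          ρ₀.IsOdd ∧ ∀ σ, ‖(ρ' σ).val.trace -
            (η σ).val 0 0 * ((ρ₀ σ).val.trace ^ 2 * ((ρ₀ σ).val.det)⁻¹ - 1)‖ < 1) :=
  fun hW => not_residualParity_of_apply_eq_one hp2 heven (forces_parity (hW ρ hdual hirr) hc)

/-- **The duality hypothesis H1 is load-bearing.**  At any prime `p`: one `ρ : Γ_ℚ →ₜ* GL₃(ℚ̄_p)`
satisfying H2 and H3 but NOT H1 (on paper: the `3`-dimensional Artin representation of a
`PSL₂(𝔽₇)`-extension of `ℚ` — Trinks' `x⁷ − 7x + 3`, three real roots, `tr ρ(c) = −1` — at any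
`p ∤ 14·disc`, where `ρ̄` and `ρ̄^∨` have conjugate, non-real character values on elements of order
`7`) falsifies the crux WITH H1 DROPPED at this `p` (written inline). [folklore] -/
theorem false_without_duality_of_nonSelfDual (ρ : FramedGaloisRep ℚ (PadicAlgCl p) 3)
    (hirr : (ρ.restrictField (CyclotomicField p ℚ)).IsResiduallyAbsIrreducible)
    (hpar : ∃ (φ : ℚ →+* ℝ) (c : Field.absoluteGaloisGroup ℚ), IsComplexConjugation φ c ∧
      ((ρ c).val.trace = 1 ∨ (ρ c).val.trace = -1))
    (hndual : ¬ ∃ ν : FramedGaloisRep ℚ (PadicAlgCl p) 1,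
      ∀ σ, ‖(ρ σ).val.trace - (ν σ).val 0 0 * (ρ σ⁻¹).val.trace‖ < 1) :
    ¬ (∀ ρ' : FramedGaloisRep ℚ (PadicAlgCl p) 3,
        (ρ'.restrictField (CyclotomicField p ℚ)).IsResiduallyAbsIrreducible →
        (∃ (φ : ℚ →+* ℝ) (c : Field.absoluteGaloisGroup ℚ), IsComplexConjugation φ c ∧
          ((ρ' c).val.trace = 1 ∨ (ρ' c).val.trace = -1)) →
        ∃ (ρ₀ : FramedGaloisRep ℚ (PadicAlgCl p) 2) (η : FramedGaloisRep ℚ (PadicAlgCl p) 1),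
          ρ₀.IsOdd ∧ ∀ σ, ‖(ρ' σ).val.trace -
            (η σ).val 0 0 * ((ρ₀ σ).val.trace ^ 2 * ((ρ₀ σ).val.det)⁻¹ - 1)‖ < 1) :=
  fun hW => hndual (forces_duality (hW ρ hirr hpar))

end Necessity

end Summit.Langlands.Langlands.Theorems.AdjointSeedFromDuality.Negative
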